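import Summits.QuantumFields.YangMills.Theses.LuscherReduction
import Summits.QuantumFields.YangMills.Theorems.LuscherReductionTraceDoorBasics
import Summits.QuantumFields.YangMills.Theorems.LuscherReductionTwistedTraceScalingOneSiteTraceLimit
import Summits.QuantumFields.YangMills.Theorems.LuscherReductionTwistedTraceScalingTowerOfUniform
import Summits.QuantumFields.YangMills.Theorems.LuscherReductionTwistedTraceScalingUniformOfCoarse
import HarnessLib

/-!
# Crux `TwistedTraceScaling` (stmt-QuantumFields-20203) IS the femto trace law `FTL`: `r(L, β, ⌈sL/Λ⌉) → r_𝔥(s)` deep in the window —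
# kernel-checked over the closed one-site trace limit; and the crux from the uniform law / the three `L`-uniform level statements

Route `LuscherReduction` (owner ym-beyond-p1), child crux `TwistedTraceScaling` (stmt-QuantumFields-20203) of RED, line «twolattice»
(sha16 a5c3dbcbf75f28d1, lead ym-lead-20203-twolattice g0).  The crux compares the vacuum-free dyadic zero-flux trace ratio of the `L³` torus
with that of the ONE-SITE model at `B = 2L³/Λ³` and the same `T = ⌈sL/Λ⌉`.  Since the one-site trace limit is CLOSED in the tree
(`TraceDoor.oneSiteTraceLimit`, from the closed children `OneSiteTail` 20204 and `TraceFormula` 20202: `r(1, B, T) → r_𝔥(s)` when `Tλ_b(B) → s`), the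
one-site side can be eliminated: the crux is EQUIVALENT to the **femto trace law**

  `FTL := ∀ s > 0, ∀ ε > 0, ∃ lam0 > 0, ∀ lam ∈ (0, lam0], ∃ L0, ∀ L ≥ L0, ∀ β ∈ W(lam, L), |traceRatio L β (femtoSteps s β L) − hTraceRatio s| ≤ ε`

— Lüscher's statement «the dyadic zero-flux heat-trace ratio of `SU(2)` Wilson theory on `(ℤ/L)³` at femto-time `s` tends to that of the zero-momentum
Hamiltonian `𝔥`» in the crux's own quantifier shape (`L0` may depend on `lam`).  Results (sorry-free, standard axioms, no definitions; `FTL` and the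
other currencies are spelled out as hypothesis texts):

* §1 ★ `twistedTraceScaling_of_femtoTraceLaw : FTL → TwistedTraceScaling` and ★ `femtoTraceLaw_of_twistedTraceScaling : TwistedTraceScaling → FTL`
  (triangle through `r_𝔥(s)` / through the one-site ratio; one-site coupling `≥ 1/(4lam³)`, `|Tλ_b − s| ≤ λ_b`, LEVEL = TRACE at one site), packaged as
  `twistedTraceScaling_iff_femtoTraceLaw`.
* §2 the crux from the STRONGER currencies of the line: `femtoTraceLaw_of_uniform : UFTL → FTL` (the `L`-uniform law of
  `…TowerOfUniform.lean`, there called `UTL`; renamed `UFTL` here to avoid the clash with cruxidea-19978-1's `UpperTraceLaw`), hence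
  ★ `twistedTraceScaling_of_uniform : UFTL → TwistedTraceScaling`, ★ `twistedTraceScaling_of_ucoarse : U-UPPER → U-LOWER → U-TAIL → TwistedTraceScaling`
  (via `Tower.uniformTraceLaw_of_ucoarse`), and ★ `twistedTraceScaling_of_tower_of_base : ⟨S-TOWER body⟩ → ⟨S-BASE body⟩ → TwistedTraceScaling`
  (the registered line's composition with S-OSTL discharged, now importable from `Theorems/`).

What this says about the line: S-TOWER ∧ S-BASE prove `UFTL` (`Tower.uniform_of_twoLattice_of_base`), which is STRICTLY MORE than the crux needs (`FTL`:
no `lam`-uniformity of `L0`); the extra uniformity is the price of routing through a fixed intermediate lattice.  Every proof of `FTL` — by whatever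
method — closes stmt-QuantumFields-20203 by `twistedTraceScaling_of_femtoTraceLaw`.

HONEST FRAMING: bookkeeping; `FTL`/`UFTL`/`U-*` are OPEN (the constructive small-volume continuum limit of the lattice transfer spectrum is not in
print); femto rung R2b1 only; nothing here is infinite volume, a mass gap or Clay.
-/

set_option autoImplicit false

noncomputable section

open MeasureTheory Filter Topology Real
open scoped BigOperators

namespace Summit.QuantumFields.YangMills.Theorems.FemtoTransferGap.TwoLattice

open Summit.QuantumFields.YangMills.Theorems.FemtoTransferGap
open Summit.QuantumFields.YangMills.Theorems.FemtoTransferGap.TraceDoor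
open Summit.QuantumFields.YangMills.Theorems.FemtoTransferGap.TT (physTrace)

namespace Tower

/-! ## §1 ★ The crux ⇔ the femto trace law -/

/-- Deep in a window of depth `lam ≤ min(1, 1/(4M), s/4)`: `β ≥ 1`, the one-site coupling is `≥ M`, and `T = femtoSteps s β L ≥ 2`. [folklore] -/
theorem deep_facts {s lam β M : ℝ} {L : ℕ} [NeZero L] (hs : 0 < s) (hM : 0 < M) (hlam : 0 < lam) (h1 : lam ≤ 1)
    (hM' : lam ≤ 1 / (4 * M)) (hs4 : lam ≤ s / 4) (hW : InFemtoWindow lam β L) :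
    1 ≤ β ∧ M ≤ oneSiteCoupling β L ∧ 2 ≤ femtoSteps s β L := by
  refine ⟨hW.1, (le_of_lam_small hlam h1 hM hM').trans (oneSiteCoupling_ge_of_window hlam hW), ?_⟩
  obtain ⟨_, hupos, hule⟩ := unit_small_of_window (τ := s / 2) hlam (by linarith) hW
  obtain ⟨hT1, _⟩ := Base.femtoSteps_mul_unit (L1 := L) hs.le hlam hW
  have h1' : (2 : ℝ) * (luscherLambda β L / L) ≤ (femtoSteps s β L : ℝ) * (luscherLambda β L / L) := by linarith
  have h2 : (2 : ℝ) ≤ (femtoSteps s β L : ℝ) := le_of_mul_le_mul_right h1' hupos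
  exact_mod_cast h2

/-- ★ **The crux from the femto trace law** (`FTL → TwistedTraceScaling`, BY NAME): triangle through `r_𝔥(s)`, the one-site side by the closed
`TraceDoor.oneSiteTraceLimit` at `B = oneSiteCoupling β L ≥ B0` with `|T·λ_b(B) − s| ≤ λ_b(B)` (`TraceDoor.femtoSteps_mul_sub_le`) and LEVEL = TRACE
at one site (`Base.traceRatio_eq_levelRatio 1`). [cite: Luscher1983, §3] [cite: MontvayMunster1994, (3.145)] -/
theorem twistedTraceScaling_of_femtoTraceLaw
    (hFTL : ∀ s : ℝ, 0 < s → ∀ ε : ℝ, 0 < ε → ∃ lam0 : ℝ, 0 < lam0 ∧ ∀ lam : ℝ, 0 < lam → lam ≤ lam0 →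
      ∃ L0 : ℕ, ∀ (L : ℕ) [NeZero L], L0 ≤ L → ∀ β : ℝ, InFemtoWindow lam β L →
        |traceRatio L β (femtoSteps s β L) - hTraceRatio s| ≤ ε) :
    Summit.QuantumFields.YangMills.Theses.LuscherReduction.TwistedTraceScaling := by
  intro s hs ε hε
  have hε2 : 0 < ε / 2 := by positivity
  obtain ⟨lamF, hlamF, hF⟩ := hFTL s hs (ε / 2) hε2
  obtain ⟨B0, hO⟩ := oneSiteTraceLimit s hs (ε / 2) hε2
  set M : ℝ := max B0 1 with hMdef
  have hM1 : 1 ≤ M := le_max_right _ _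
  have hMpos : 0 < M := lt_of_lt_of_le one_pos hM1
  refine ⟨min (min lamF 1) (min (1 / (4 * M)) (s / 4)),
    lt_min (lt_min hlamF one_pos) (lt_min (by positivity) (by positivity)), ?_⟩
  intro lam hlam hle
  have hleF : lam ≤ lamF := hle.trans ((min_le_left _ _).trans (min_le_left _ _))
  have hle1 : lam ≤ 1 := hle.trans ((min_le_left _ _).trans (min_le_right _ _))
  have hleM : lam ≤ 1 / (4 * M) := hle.trans ((min_le_right _ _).trans (min_le_left _ _))
  have hles : lam ≤ s / 4 := hle.trans ((min_le_right _ _).trans (min_le_right _ _))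
  obtain ⟨L0, hL⟩ := hF lam hlam hleF
  refine ⟨L0, ?_⟩
  intro L _ hL0 β hW
  obtain ⟨_, hBM, hT2⟩ := deep_facts hs hMpos hlam hle1 hleM hles hW
  have hB0le : B0 ≤ oneSiteCoupling β L := (le_max_left _ _).trans hBM
  have hBone : 1 ≤ oneSiteCoupling β L := hM1.trans hBM
  have hfine := hL L hL0 β hW
  have hOs := hO (oneSiteCoupling β L) hB0le (femtoSteps s β L) (femtoSteps_mul_sub_le hs.le hlam hW)
  rw [← Base.traceRatio_eq_levelRatio 1 hBone hT2, abs_sub_comm] at hOs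
  show |traceRatio L β (femtoSteps s β L) - traceRatio 1 (oneSiteCoupling β L) (femtoSteps s β L)| ≤ ε
  calc |traceRatio L β (femtoSteps s β L) - traceRatio 1 (oneSiteCoupling β L) (femtoSteps s β L)|
      = |(traceRatio L β (femtoSteps s β L) - hTraceRatio s) +
          (hTraceRatio s - traceRatio 1 (oneSiteCoupling β L) (femtoSteps s β L))| := by congr 1; ring
    _ ≤ |traceRatio L β (femtoSteps s β L) - hTraceRatio s| +
          |hTraceRatio s - traceRatio 1 (oneSiteCoupling β L) (femtoSteps s β L)| := abs_add_le _ _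
    _ ≤ ε := by linarith

/-- ★ **The femto trace law from the crux** (`TwistedTraceScaling → FTL`): the same triangle, read the other way. [cite: Luscher1983, §3] -/
theorem femtoTraceLaw_of_twistedTraceScaling
    (hTTS : Summit.QuantumFields.YangMills.Theses.LuscherReduction.TwistedTraceScaling) :
    ∀ s : ℝ, 0 < s → ∀ ε : ℝ, 0 < ε → ∃ lam0 : ℝ, 0 < lam0 ∧ ∀ lam : ℝ, 0 < lam → lam ≤ lam0 →
      ∃ L0 : ℕ, ∀ (L : ℕ) [NeZero L], L0 ≤ L → ∀ β : ℝ, InFemtoWindow lam β L →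
        |traceRatio L β (femtoSteps s β L) - hTraceRatio s| ≤ ε := by
  intro s hs ε hε
  have hε2 : 0 < ε / 2 := by positivity
  obtain ⟨lamT, hlamT, hT⟩ := (twistedTraceScaling_iff.1 hTTS) s hs (ε / 2) hε2
  obtain ⟨B0, hO⟩ := oneSiteTraceLimit s hs (ε / 2) hε2
  set M : ℝ := max B0 1 with hMdef
  have hM1 : 1 ≤ M := le_max_right _ _
  have hMpos : 0 < M := lt_of_lt_of_le one_pos hM1
  refine ⟨min (min lamT 1) (min (1 / (4 * M)) (s / 4)),
    lt_min (lt_min hlamT one_pos) (lt_min (by positivity) (by positivity)), ?_⟩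
  intro lam hlam hle
  have hleT : lam ≤ lamT := hle.trans ((min_le_left _ _).trans (min_le_left _ _))
  have hle1 : lam ≤ 1 := hle.trans ((min_le_left _ _).trans (min_le_right _ _))
  have hleM : lam ≤ 1 / (4 * M) := hle.trans ((min_le_right _ _).trans (min_le_left _ _))
  have hles : lam ≤ s / 4 := hle.trans ((min_le_right _ _).trans (min_le_right _ _))
  obtain ⟨L0, hL⟩ := hT lam hlam hleT
  refine ⟨L0, ?_⟩
  intro L _ hL0 β hW
  obtain ⟨_, hBM, hT2⟩ := deep_facts hs hMpos hlam hle1 hleM hles hW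
  have hB0le : B0 ≤ oneSiteCoupling β L := (le_max_left _ _).trans hBM
  have hBone : 1 ≤ oneSiteCoupling β L := hM1.trans hBM
  have hcrux := hL L hL0 β hW
  have hOs := hO (oneSiteCoupling β L) hB0le (femtoSteps s β L) (femtoSteps_mul_sub_le hs.le hlam hW)
  rw [← Base.traceRatio_eq_levelRatio 1 hBone hT2] at hOs
  calc |traceRatio L β (femtoSteps s β L) - hTraceRatio s|
      = |(traceRatio L β (femtoSteps s β L) - traceRatio 1 (oneSiteCoupling β L) (femtoSteps s β L)) +
          (traceRatio 1 (oneSiteCoupling β L) (femtoSteps s β L) - hTraceRatio s)| := by congr 1; ring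
    _ ≤ |traceRatio L β (femtoSteps s β L) - traceRatio 1 (oneSiteCoupling β L) (femtoSteps s β L)| +
          |traceRatio 1 (oneSiteCoupling β L) (femtoSteps s β L) - hTraceRatio s| := abs_add_le _ _
    _ ≤ ε := by linarith

/-- ★ **`TwistedTraceScaling ↔ FTL`**: child crux stmt-QuantumFields-20203 is the femto trace law, given the tree's closed one-site trace limit.
[cite: Luscher1983, §3] -/
theorem twistedTraceScaling_iff_femtoTraceLaw :
    Summit.QuantumFields.YangMills.Theses.LuscherReduction.TwistedTraceScaling ↔
      (∀ s : ℝ, 0 < s → ∀ ε : ℝ, 0 < ε → ∃ lam0 : ℝ, 0 < lam0 ∧ ∀ lam : ℝ, 0 < lam → lam ≤ lam0 →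
        ∃ L0 : ℕ, ∀ (L : ℕ) [NeZero L], L0 ≤ L → ∀ β : ℝ, InFemtoWindow lam β L →
          |traceRatio L β (femtoSteps s β L) - hTraceRatio s| ≤ ε) :=
  ⟨femtoTraceLaw_of_twistedTraceScaling, twistedTraceScaling_of_femtoTraceLaw⟩

/-! ## §2 ★ The crux from the line's stronger currencies: `UFTL`, the three `L`-uniform level statements, S-TOWER ∧ S-BASE -/

/-- The `L`-uniform femto trace law (`L0` independent of `lam`) trivially implies the femto trace law. [folklore] -/
theorem femtoTraceLaw_of_uniform
    (hU : ∀ s : ℝ, 0 < s → ∀ ε : ℝ, 0 < ε → ∃ L0 : ℕ, ∃ lam0 : ℝ, 0 < lam0 ∧ ∀ lam : ℝ, 0 < lam → lam ≤ lam0 →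
      ∀ (L : ℕ) [NeZero L], L0 ≤ L → ∀ β : ℝ, InFemtoWindow lam β L →
        |traceRatio L β (femtoSteps s β L) - hTraceRatio s| ≤ ε) :
    ∀ s : ℝ, 0 < s → ∀ ε : ℝ, 0 < ε → ∃ lam0 : ℝ, 0 < lam0 ∧ ∀ lam : ℝ, 0 < lam → lam ≤ lam0 →
      ∃ L0 : ℕ, ∀ (L : ℕ) [NeZero L], L0 ≤ L → ∀ β : ℝ, InFemtoWindow lam β L →
        |traceRatio L β (femtoSteps s β L) - hTraceRatio s| ≤ ε := by
  intro s hs ε hε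
  obtain ⟨L0, lam0, hlam0, h⟩ := hU s hs ε hε
  exact ⟨lam0, hlam0, fun lam hlam hle => ⟨L0, fun L _ hL β hW => h lam hlam hle L hL β hW⟩⟩

/-- ★ **The crux from the `L`-uniform femto trace law** (the hypothesis of `Tower.twoLatticeUniversality_of_uniform`). [cite: Luscher1983, §3] -/
theorem twistedTraceScaling_of_uniform
    (hU : ∀ s : ℝ, 0 < s → ∀ ε : ℝ, 0 < ε → ∃ L0 : ℕ, ∃ lam0 : ℝ, 0 < lam0 ∧ ∀ lam : ℝ, 0 < lam → lam ≤ lam0 →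
      ∀ (L : ℕ) [NeZero L], L0 ≤ L → ∀ β : ℝ, InFemtoWindow lam β L →
        |traceRatio L β (femtoSteps s β L) - hTraceRatio s| ≤ ε) :
    Summit.QuantumFields.YangMills.Theses.LuscherReduction.TwistedTraceScaling :=
  twistedTraceScaling_of_femtoTraceLaw (femtoTraceLaw_of_uniform hU)

/-- ★ **The crux from the three `L`-uniform level statements U-UPPER ∧ U-LOWER ∧ U-TAIL** (texts of `…UniformOfCoarse.lean`), via
`Tower.uniformTraceLaw_of_ucoarse`. [cite: Luscher1983, §3] [cite: LuscherMunster1984, §2] -/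
theorem twistedTraceScaling_of_ucoarse
    (hUp : ∀ k : ℕ, ∀ d : ℝ, d < levelGap k → ∃ L0 : ℕ, ∃ lam0 : ℝ, 0 < lam0 ∧ ∀ lam : ℝ, 0 < lam → lam ≤ lam0 →
      ∀ (L : ℕ) [NeZero L], L0 ≤ L → ∀ β : ℝ, InFemtoWindow lam β L →
        levelValue su2Rep L β k ≤ Real.exp (-(d * luscherLambda β L) / L) * levelValue su2Rep L β 0)
    (hLow : ∀ k : ℕ, ∀ ε : ℝ, 0 < ε → ∃ L0 : ℕ, ∃ lam0 : ℝ, 0 < lam0 ∧ ∀ lam : ℝ, 0 < lam → lam ≤ lam0 →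
      ∀ (L : ℕ) [NeZero L], L0 ≤ L → ∀ β : ℝ, InFemtoWindow lam β L →
        Real.exp (-((levelGap k + ε) * luscherLambda β L) / L) * levelValue su2Rep L β 0 ≤ levelValue su2Rep L β k)
    (hTail : ∀ s : ℝ, 0 < s → ∀ ε : ℝ, 0 < ε → ∃ K : ℕ, ∃ L0 : ℕ, ∃ lam0 : ℝ, 0 < lam0 ∧ ∀ lam : ℝ, 0 < lam → lam ≤ lam0 →
      ∀ (L : ℕ) [NeZero L], L0 ≤ L → ∀ β : ℝ, InFemtoWindow lam β L →
        ∀ T : ℕ, s ≤ 2 * ((T : ℝ) * (luscherLambda β L / L)) →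
          ∑' k : ℕ, (levelValue su2Rep L β (k + K) / levelValue su2Rep L β 0) ^ T ≤ ε) :
    Summit.QuantumFields.YangMills.Theses.LuscherReduction.TwistedTraceScaling :=
  twistedTraceScaling_of_uniform (uniformTraceLaw_of_ucoarse hUp hLow hTail)

/-- ★ **The crux from S-TOWER ∧ S-BASE** (hypotheses = VERBATIM the bodies of the registered `Stmt.stub_twoLatticeUniversality` and
`Stmt.stub_fixedLatticeTraceLaw` of line «twolattice», sha16 a5c3dbcbf75f28d1; S-OSTL is discharged by the tree): the registered composition
`TwistedTraceScaling_of`, routed through `UFTL` (`Tower.uniform_of_twoLattice_of_base`). [cite: Luscher1983, §3] [cite: Balaban1989LargeFieldII, p.355] -/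
theorem twistedTraceScaling_of_tower_of_base
    (hTOWER : ∀ s : ℝ, 0 < s → ∀ ε : ℝ, 0 < ε → ∃ L0 : ℕ, ∃ lam0 : ℝ, 0 < lam0 ∧ ∀ lam : ℝ, 0 < lam → lam ≤ lam0 →
      ∀ (L1 : ℕ) [NeZero L1], L0 ≤ L1 → ∀ (L : ℕ) [NeZero L], L1 ≤ L → ∀ β : ℝ, InFemtoWindow lam β L →
        ∀ β₁ : ℝ, 1 ≤ β₁ → invRunningCoupling β₁ L1 = invRunningCoupling β L →
          |traceRatio L β (femtoSteps s β L) - traceRatio L1 β₁ (femtoSteps s β₁ L1)| ≤ ε)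
    (hBASE : ∀ (L1 : ℕ) [NeZero L1] (s : ℝ), 0 < s → ∀ ε : ℝ, 0 < ε → ∃ β1 : ℝ, ∀ β : ℝ, β1 ≤ β →
      |traceRatio L1 β (femtoSteps s β L1) - hTraceRatio s| ≤ ε) :
    Summit.QuantumFields.YangMills.Theses.LuscherReduction.TwistedTraceScaling :=
  twistedTraceScaling_of_uniform (uniform_of_twoLattice_of_base hTOWER hBASE)

end Tower

end Summit.QuantumFields.YangMills.Theorems.FemtoTransferGap.TwoLattice

end
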